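import Literature.LinearAlgebra.Alternating.WedgeOne

/-!
# Interior products of alternatized families, and the commutator `[w ⌟, L_θ]`

Continuation of `Literature/LinearAlgebra/Alternating/WedgeOne.lean` (CAR identities for
`θ ∧ ·` and `w ⌟ ·`). For a continuous linear family `f : E →L[𝕜] E [⋀^Fin n]→L[𝕜] F` Mathlib's
`alternatizeUncurryFin f` is the `(n+1)`-form `v ↦ ∑ᵢ (-1)ⁱ f(vᵢ)(v₀,…,v̂ᵢ,…,vₙ)`; we record

* `curryLeft_alternatizeUncurryFin_eq`: `w ⌟ alternatizeUncurryFin f = f w - alternatizeUncurryFin (w ⌟ f)`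
  (the first-slot expansion; Warner (1983), 2.11: interior multiplication is an antiderivation);
* the **Lefschetz-type operators** `L_θ η = alternatizeUncurryFin (v ↦ θ(v) ∧ η)` attached to a
  continuous family of covectors `θ : E →L[𝕜] E →L[𝕜] 𝕜` (for the bilinear form
  `θ(v)(w) = ½ g(Jv, w)` of a Hermitian structure this is `η ↦ ω ∧ η`, the Lefschetz operator of
  Kähler geometry, in the alternatization convention of Mathlib's `extDeriv`), and their
  commutator with interior products,
  `curryLeft_lefschetz_sub`: `w ⌟ L_θ η - L_θ (w ⌟ η) = (θ w - θᵗ w) ∧ η`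
  (`θᵗ w = θ(·)(w)`), i.e. `[w ⌟, L_θ] = (ι_w ω_θ) ∧ ·` with `ω_θ(v, w) = θ(v)(w) - θ(w)(v)` the
  alternation of `θ` — the pointwise identity `[ι_w, L] = (ι_w ω) ∧ ·` behind the Kähler identity
  `[∂̄*, L] = i∂` (Voisin (2002), Lemma 6.6; Huybrechts (2005), Prop. 1.2.26 / proof of Prop. 3.1.12).

Everything is stated hypothesis-style (`hΦ : ∀ v, Φ v = θ v ∧ η`), as in
`FormsAlgebraWedgeProofs.alternatizeUncurryFin_wedge_left`, so that no new definition is needed.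

## References

* F. W. Warner, *Foundations of Differentiable Manifolds and Lie Groups* (1983), 2.10–2.11.
  [Warner1983]
* C. Voisin, *Hodge Theory and Complex Algebraic Geometry I* (2002), §6.1.1, Lemma 6.6.
  [Voisin2002]
* D. Huybrechts, *Complex Geometry* (2005), Prop. 1.2.26, Prop. 3.1.12. [Huybrechts2005]
-/

noncomputable section

open ContinuousAlternatingMap Function

namespace Literature.LinearAlgebra.Alternating

variable {𝕜 : Type*} [NontriviallyNormedField 𝕜] {E : Type*} [NormedAddCommGroup E]
  [NormedSpace 𝕜 E] {F : Type*} [NormedAddCommGroup F] [NormedSpace 𝕜 F] {n : ℕ}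

/-! ### Interior product of an alternatized family -/

/-- **First-slot expansion**: `w ⌟ alternatizeUncurryFin f = f w - alternatizeUncurryFin (w ⌟ f)`,
where `(w ⌟ f)(v) = w ⌟ f(v)` (hypothesis `hg`). Warner (1983), 2.11. [cite: Warner1983, 2.11] -/
theorem curryLeft_alternatizeUncurryFin_eq (f : E →L[𝕜] E [⋀^Fin (n + 1)]→L[𝕜] F) (w : E)
    (g : E →L[𝕜] E [⋀^Fin n]→L[𝕜] F) (hg : ∀ v, g v = (f v).curryLeft w) :
    (alternatizeUncurryFin f).curryLeft w = f w - alternatizeUncurryFin g := by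
  ext v
  rw [curryLeft_apply_apply, alternatizeUncurryFin_apply, Fin.sum_univ_succ,
    ContinuousAlternatingMap.sub_apply, alternatizeUncurryFin_apply]
  simp only [Fin.val_zero, pow_zero, one_smul, Matrix.cons_val_zero, removeNth_zero_vecCons,
    Matrix.cons_val_succ, Fin.val_succ, pow_succ, mul_neg_one, neg_smul, Finset.sum_neg_distrib,
    removeNth_succ_vecCons, hg, curryLeft_apply_apply, sub_eq_add_neg]

/-- In degree `0` the second term is absent: `w ⌟ alternatizeUncurryFin f = f w` for a family of
`0`-forms. [cite: Warner1983, 2.11] -/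
theorem curryLeft_alternatizeUncurryFin_zero (f : E →L[𝕜] E [⋀^Fin 0]→L[𝕜] F) (w : E) :
    (alternatizeUncurryFin f).curryLeft w = f w := by
  ext v
  rw [curryLeft_apply_apply, alternatizeUncurryFin_apply, Fin.sum_univ_succ]
  simp only [Fin.val_zero, pow_zero, one_smul, Matrix.cons_val_zero, Finset.univ_eq_empty,
    Finset.sum_empty, add_zero]
  congr 1

/-- `alternatizeUncurryFin` commutes with subtraction (it is linear). [folklore] -/
theorem alternatizeUncurryFin_sub (f g : E →L[𝕜] E [⋀^Fin n]→L[𝕜] F) :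
    alternatizeUncurryFin (f - g) = alternatizeUncurryFin f - alternatizeUncurryFin g := by
  rw [← alternatizeUncurryFinCLM_apply, ← alternatizeUncurryFinCLM_apply,
    ← alternatizeUncurryFinCLM_apply, map_sub]

section WedgeOne

variable {𝕜' : Type*} [NormedField 𝕜'] [NormedAlgebra 𝕜 𝕜'] [NormedSpace 𝕜' F]
  [IsScalarTower 𝕜 𝕜' F]

/-- `(-θ) ∧ η = -(θ ∧ η)`. [folklore] -/
theorem wedgeOne_neg_left (θ : E →L[𝕜] 𝕜') (η : E [⋀^Fin n]→L[𝕜] F) :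
    wedgeOne (-θ) η = -wedgeOne θ η := by
  ext v
  simp [wedgeOne_apply]

/-- `θ ∧ η` is subtractive in `θ`. [folklore] -/
theorem wedgeOne_sub_left (θ₁ θ₂ : E →L[𝕜] 𝕜') (η : E [⋀^Fin n]→L[𝕜] F) :
    wedgeOne (θ₁ - θ₂) η = wedgeOne θ₁ η - wedgeOne θ₂ η := by
  rw [sub_eq_add_neg, wedgeOne_add_left, wedgeOne_neg_left, ← sub_eq_add_neg]

end WedgeOne

/-! ### The commutator of an interior product with a Lefschetz-type operator -/

/-- **`[w ⌟, L_θ] = (ι_w ω_θ) ∧ ·`** in positive degree. For a continuous family of covectors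
`θ : E →L[𝕜] E →L[𝕜] 𝕜`, an `(n+1)`-form `η` and a vector `w`, with
`L_θ η = alternatizeUncurryFin (v ↦ θ v ∧ η)` (hypothesis `hΦ`) and
`L_θ (w ⌟ η) = alternatizeUncurryFin (v ↦ θ v ∧ (w ⌟ η))` (hypothesis `hΨ`):
`w ⌟ L_θ η = (θ w - θᵗ w) ∧ η + L_θ (w ⌟ η)`, where `θᵗ w = θ.flip w = θ(·)(w)`. With
`θ v = ½ g(Jv, ·)` this is `[ι_w, ω ∧] = (ι_w ω) ∧` (Huybrechts (2005), proof of Prop. 1.2.26;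
Voisin (2002), proof of Lemma 6.6). Proof: first-slot expansion and the CAR identity
`w ⌟ (θ v ∧ η) = θ v w • η - θ v ∧ (w ⌟ η)` (`curryLeft_wedgeOne`); the family
`v ↦ θ v w • η` alternatizes to `θᵗ w ∧ η` by definition of `wedgeOne`.
[cite: Voisin2002, Lemma 6.6] -/
theorem curryLeft_lefschetz_eq (θ : E →L[𝕜] E →L[𝕜] 𝕜) (η : E [⋀^Fin (n + 1)]→L[𝕜] F) (w : E)
    (Φ : E →L[𝕜] E [⋀^Fin (n + 2)]→L[𝕜] F) (hΦ : ∀ v, Φ v = wedgeOne (θ v) η)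
    (Ψ : E →L[𝕜] E [⋀^Fin (n + 1)]→L[𝕜] F) (hΨ : ∀ v, Ψ v = wedgeOne (θ v) (η.curryLeft w)) :
    (alternatizeUncurryFin Φ).curryLeft w =
      wedgeOne (θ w - θ.flip w) η + alternatizeUncurryFin Ψ := by
  -- the family `v ↦ w ⌟ Φ v = θ v w • η - θ v ∧ (w ⌟ η)`
  have hg : ∀ v, ((θ.flip w).smulRight η - Ψ) v = (Φ v).curryLeft w := fun v ↦ by
    rw [_root_.sub_apply, ContinuousLinearMap.smulRight_apply, hΦ, hΨ,
      curryLeft_wedgeOne, ContinuousLinearMap.flip_apply]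
  have hflip : alternatizeUncurryFin ((θ.flip w).smulRight η) = wedgeOne (θ.flip w) η := rfl
  rw [curryLeft_alternatizeUncurryFin_eq Φ w _ hg, hΦ, alternatizeUncurryFin_sub, hflip,
    wedgeOne_sub_left]
  abel

/-- **`[w ⌟, L_θ] = (ι_w ω_θ) ∧ ·`** on `0`-forms (no term `L_θ (w ⌟ η)`):
`w ⌟ L_θ η = (θ w - θᵗ w) ∧ η`. [cite: Voisin2002, Lemma 6.6] -/
theorem curryLeft_lefschetz_zero (θ : E →L[𝕜] E →L[𝕜] 𝕜) (η : E [⋀^Fin 0]→L[𝕜] F) (w : E)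
    (Φ : E →L[𝕜] E [⋀^Fin 1]→L[𝕜] F) (hΦ : ∀ v, Φ v = wedgeOne (θ v) η) :
    (alternatizeUncurryFin Φ).curryLeft w = wedgeOne (θ w - θ.flip w) η := by
  have hg : ∀ v, ((θ.flip w).smulRight η) v = (Φ v).curryLeft w := fun v ↦ by
    rw [ContinuousLinearMap.smulRight_apply, hΦ, curryLeft_wedgeOne_zero,
      ContinuousLinearMap.flip_apply]
  have hflip : alternatizeUncurryFin ((θ.flip w).smulRight η) = wedgeOne (θ.flip w) η := rfl
  rw [curryLeft_alternatizeUncurryFin_eq Φ w _ hg, hΦ, hflip, wedgeOne_sub_left]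

end Literature.LinearAlgebra.Alternating
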